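/-
ι₁ ∕ Id CHAIN TWIN (ASSEMBLER d2bridge-plan g3 MODULE TABLE v1.2, rows I6∕I7, pen prove-3 g3 = prover-pub-hodgecm2-d2bridge-prove-3-g3-0;
coordinator ruling «WORLD = C», pub-hodgecm2/INBOX l.12481, item (4) «(c)+(d) closure at ι₁»): the accepted module of the same name under
`CorCM/D2Bridge/` RE-TYPED over the UNTWISTED honest Prop-C.5 datum `Model.honestP5IdOf h F ι₁ V Φ` (✔-pending `HComp/HonestP5Id.lean`,
instlevel-a) and the J2 interface `ComponentAlbaneseId` (`D2Bridge/Iota1/ComponentAlbanese.lean`, pin-a) — instance = tail = key = ι₁.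
MECHANICAL TOKEN FLIP (`Model.honestP5Of ↦ Model.honestP5IdOf`, `ComponentAlbanese ↦ ComponentAlbaneseId`, namespace
`…CorCM.D2Bridge ↦ …CorCM.D2Bridge.Iota1`); statements, proofs and docstrings otherwise BYTE-IDENTICAL to the twisted original, which stays
as landed.  HC_CM is NOT proved; «Δ2 BRIDGE CLOSED» is NOT claimed.
ORIGINAL HEADER FOLLOWS.
Copyright (c) 2026 the pub-hodgecm2 formalisation cell (harness21).  New file, outside the frozen port manifest.
Origin: seat `prover-pub-hodgecm2-d2bridge-prove-2-g1-0` (Δ2 BRIDGE team; ASSEMBLER DECISION #7 (3), pub-hodgecm2/INBOX l.10974: the S2 PIN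
`Map43RecordAtPin`; part 1 of 2 = the definitions), 2026-08-23.  No named fact, no `sorry`, no new axiom; HC_CM is NOT proved.
-/
import Summits.HodgeConjecture.CorCM.D2Bridge.OmegaLevelwisePullbackLaws
import Summits.HodgeConjecture.CorCM.D2Bridge.HcmMLine
import Summits.HodgeConjecture.CorCM.D2Bridge.HcmJ3PullbackDetects
import Summits.HodgeConjecture.CorCM.D2Bridge.HcmS4BaseChangePullback
import Summits.HodgeConjecture.CorCM.D2Bridge.TowerRationalFormEquivariant
import Summits.HodgeConjecture.CorCM.D2Bridge.Iota1.ComponentAlbanese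
import Summits.HodgeConjecture.CorCM.D2Bridge.Map43RecordAtPinLevels
import Literature.AlgebraicGeometry.Motives.AbelianVarietyBaseChangeFaithful
import HarnessLib

set_option autoImplicit false

/-!
# Δ2 bridge, the S2 PIN (part 1, definitions): the proof-objects record `M` of [Liu2021] Thm. 4.18 AT THE MODEL'S TOWER

Y. Liu, *Fourier–Jacobi cycles and arithmetic relative trace formula*, Camb. J. Math. **9** (2021) 1–147 = arXiv:2102.11518 [Liu2021];
TeX source `FJcycle.tex` (`l. NNNN` = its lines).

The binder group R2 «`M ∕ jH ∕ hjHinj ∕ hjH`» of the Δ2 bridge (the rational record `Map43RationalData` of the proof's map (4.2)/(4.3), proof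
of Thm. 4.18 l. 2247–2253, read into the model's tower `T.H = Tower … V`), built AT THE PIN'S NAMES — J1 (`TowerRationalForm[Equivariant]`:
`TowerQ ∕ towerRepQ ∕ Tower ∕ towerRep ∕ ιT ∕ levelQ ∕ ofQ ∕ restrictQ ∕ translateQ`), the CM line (`HcmMLine`), J3 (`exists_inv_natCast_tmul`),
the HONEST rational Betti cohomology `H¹_B((A_K ⊗_{E,ι₁} ℂ)(ℂ); ℚ)` (`BettiUniverse.pull`, `Hom.baseChange`) — GENERIC over ONE interface, the
J2 pin «Albanese on components» (`ComponentAlbaneseId`: the level dictionary `Γof`, the component Albanese morphisms `alb K h : P_{Γ_K,h} ⟶ A_K ⊗ ℂ`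
= Liu's `(α_{X_K})_x|_{X_{K,h}}`, proof of Lem. 2.4 (1) l. 1220–1222, and their four laws ON `H¹`; prove-5's `AlbaneseOnComponents.lean`):
§1 `ComponentAlbaneseId`; §2 `trPullQ_one_one`; §3 `albStarQ K : H¹(A_K ⊗ ℂ; ℚ) →ₗ[ℚ] levelQ Γ_K` («pull back along every component», LAW
(ii)) with `albStarQ_pull_Atr` (LAW (iii) = `restrictQ`) and `albStarQ_pull_albTr` (LAW (iv) = `restrictQ ∘ translateQ`); §4 `levelwisePin` —
THE `LevelwiseBettiPullback` AT THE PIN (`AKQ K := H¹_B((A_K ⊗ ℂ)(ℂ); ℚ)`, `phiStarQ K φ := (φ ⊗ ℂ)^*`, `pbQ u := (u ⊗ ℂ)^*`,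
`transKQ K := ofQ Γ_K ∘ albStarQ K`) with `hpost`, `hU` (`ρUPin := towerRepQ` read on `C.G`) and the INJECTIVITY of the constructed (4.2)
(`PΩ_injective_of_levelwise` + common denominators + `ofQ_injective` + hom-level detection (v′)); §5 `map43RecordAtPin` — THE RECORD with
all four `P`-laws DISCHARGED, the S2 field terms `AKPin ∕ transKPin ∕ phiStarPin` of `HcmPieces`, and the S₀ reading `jHPin := id`.  Part 2 (`Map43RecordAtPin.lean`, theorems only): unfoldings, the S₀ binders, the S2 law `P_eq`, the S3/S4
junction.  Nothing about Liu's objects is asserted; the pin inputs left displayed are `J : ComponentAlbaneseId …`, `Dμ`, `τ' ∕ hτ'`; HC_CM is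
NOT proved; «Δ2 BRIDGE CLOSED» is NOT claimed.

## References
* [Liu2021] §2.1 Def. 2.3, Lem. 2.4 (1) with proof (l. 1202–1228); §4.2 l. 2062–2081; Def. 4.16 ∕ Rem. 4.17 (l. 2215–2228); Thm. 4.18 (1)
  (l. 2239); proof of Thm. 4.18, map (4.2)/(4.3) (l. 2247–2253); l. 650 with Def. 4.5 (2).
* Tree: `CorCM/D2Bridge/OmegaLevelwisePullback[Laws]`, `HcmMLine`, `HcmJ3PullbackDetects`, `HcmS4BaseChangePullback`, `TowerRationalForm[Equivariant]`
  (J1), `AlbaneseOnPiece{Core,Functorial}` (J2 core), `HodgeCM/Model/TowerLevel_1 ∕ TowerCarrier ∕ TowerRes ∕ LevelTranslate ∕ LevelConjugate`.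
-/

noncomputable section

open scoped TensorProduct
open CategoryTheory NumberField Function
open Literature.AlgebraicGeometry.Motives (AbelianVariety bettiCohomology)
open Literature.AlgebraicGeometry.HodgeTheory
open Literature.AlgebraicGeometry.ShimuraVarieties.UnitaryCanonicalModel (exists_recordSystem)
open Literature.NumberTheory.Automorphic Literature.NumberTheory.Automorphic.Liu2021 Literature.NumberTheory.Automorphic.Liu2021.AppendixC
open Literature.NumberTheory.Automorphic.Liu2021.AppendixC.RestOne
open Literature.NumberTheory.Automorphic.PicardCM
open Literature.NumberTheory.Transcendental (Arapura2012_Cor_15_4_6)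
open HodgeCM.Model.LevelTranslate HodgeCM.Model.TowerLevel HodgeCM.Model.TowerCarrier
open Summit.HodgeConjecture.CorCM.D2Bridge.TowerRational

namespace Summit.HodgeConjecture.CorCM.D2Bridge.Iota1

-- (Id twin, kernel-lane shape: every standing row is an IMPLICIT section variable, determined by the type of the explicit
--  interface `J : ComponentAlbaneseId hHD hI hU h₃ hA V h Φ C T`; `ρUPin ∕ ρBPin` re-bind the rows they need explicitly, as in the original.)
variable {hHD : exists_isReal_hodgeModel} {hI : hodgePQ_independent_of_hodgeModel}
  {hU : BallQuotientUniformisedDatum} {h₃ : CMAbelianVarietyRealised} {hA : Arapura2012_Cor_15_4_6}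
variable {L : HodgeCM.CMField} {ι₁ : L →+* ℂ}

/-! ## §2  (`trPullQ_one_one` is P5-free: imported from the twisted original, not re-declared) -/

variable {V : HodgeCM.HermSpace3 L ι₁} {h : exists_recordSystem} {Φ : Literature.AlgebraicGeometry.Motives.CMType L}
  {isotropicAt : ℕ → Prop}
  {C : Sec42Data (Model.honestP5IdOf h ⟨L.K⟩ ι₁ ⟨V.Hm, V.isHermitian, V.signature_ι₁, V.posDef_of_ne⟩ Φ) isotropicAt}
  {T : C.HeckeTranslates} [Algebra L ℂ]

variable (J : ComponentAlbaneseId hHD hI hU h₃ hA V h Φ C T)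

namespace ComponentAlbaneseId

/-! ## §3  `albStarQ`: pulling back along all component Albanese morphisms gives a rational level-`K` family -/

/-- **`albStarQ K : H¹_B((A_K ⊗ ℂ)(ℂ); ℚ) →ₗ[ℚ] U_K = levelQ Γ_K`**, `x ↦ (h ↦ (alb K h)^* x)` — the rational level-`K` family of a class
of the Albanese variety ([Liu2021] proof of Lem. 2.4 (1): `(α_X)_x^*` on `H¹`, component by component); membership in the rational level
is LAW (ii) through J1's `mem_levelQ_iff_rel`. [cite: Liu2021, proof of Lemma 2.4 (1) (FJcycle.tex l. 1220–1228)] -/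
def albStarQ (K : C5.SmallLevel C.S.K₀) :
    bettiCohomology ((C.A K).baseChange ℂ).X 1 →ₗ[ℚ] levelQ hHD hI hU h₃ hA (J.Γof K) (J.belowConjThree K) where
  toFun x := ⟨fun g => BettiUniverse.pull (J.alb K g) 1 x, (mem_levelQ_iff_rel hHD hI hU h₃ hA).2 fun γ g g' r =>
    LinearMap.congr_fun (J.pull_alb_rel K γ g g' r) x⟩
  map_add' x y := by
    apply Subtype.ext
    funext g
    exact map_add (BettiUniverse.pull (J.alb K g) 1) x y
  map_smul' q x := by
    apply Subtype.ext
    funext g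
    exact map_smul (BettiUniverse.pull (J.alb K g) 1) q x

/-- Unfolding, componentwise: `(albStarQ K x) h = (alb K h)^* x`. [cite: Liu2021, proof of Lemma 2.4 (1) (FJcycle.tex l. 1220–1222)] -/
@[simp] theorem coe_albStarQ_apply (K : C5.SmallLevel C.S.K₀) (x : bettiCohomology ((C.A K).baseChange ℂ).X 1) (g : ↥V.adelicFin) :
    (ComponentAlbaneseId.albStarQ J K x : Π g : ↥V.adelicFin, WQ hHD hI hU h₃ (J.Γof K) (J.belowConjThree K) g) g =
      BettiUniverse.pull (J.alb K g) 1 x :=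
  rfl

/-- **LAW (iii) in level form**: pulling back along the transition `Alb_{u^{K'}_K}` and then along the components of `X_{K'}` is the
rational change of level `restrictQ` of the family at level `K` ([Liu2021] §4.2 l. 2070–2072). [cite: Liu2021, §4.2 (FJcycle.tex l. 2062–2072)] -/
theorem albStarQ_pull_Atr {K K' : C5.SmallLevel C.S.K₀} (f : K' ⟶ K) (x : bettiCohomology ((C.A K).baseChange ℂ).X 1) :
    ComponentAlbaneseId.albStarQ J K' (BettiUniverse.pull (AbelianVariety.Hom.baseChange ℂ (C.Atr f)).hom.hom.hom 1 x) =
      restrictQ hHD hI hU h₃ hA (J.Γof_mono f.le) (J.belowConjThree K) (J.belowConjThree K') (ComponentAlbaneseId.albStarQ J K x) := by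
  apply Subtype.ext
  funext g
  rw [coe_albStarQ_apply, coe_restrictQ_apply, coe_albStarQ_apply]
  exact LinearMap.congr_fun (J.pull_alb_Atr f g) x

/-- **LAW (iv) in level form**: pulling back along the Hecke translate `Alb(T_g) : A_{K₁} → A_K` (`g⁻¹ K₁ g ⊆ K`) and then along the
components of `X_{K₁}` is the rational TRANSLATE `translateQ g` of the family at level `K`, restricted from `g K g⁻¹` to `K₁`
([Liu2021] §4.2 l. 2074; the tower's action is re-indexing `h ↦ h g`). [cite: Liu2021, §4.2 (FJcycle.tex l. 2070–2074)] -/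
theorem albStarQ_pull_albTr (g : ↥V.adelicFin) {K₁ K : C5.SmallLevel C.S.K₀} (hK : C5.HeckeLE g K₁ K)
    (x : bettiCohomology ((C.A K).baseChange ℂ).X 1) :
    ComponentAlbaneseId.albStarQ J K₁ (BettiUniverse.pull (AbelianVariety.Hom.baseChange ℂ (T.albTr g K₁ K hK)).hom.hom.hom 1 x) =
      restrictQ hHD hI hU h₃ hA (J.Γof_hecke g hK) ((J.belowConjThree K).conj g) (J.belowConjThree K₁)
        (translateQ hHD hI hU h₃ hA (J.belowConjThree K) g (ComponentAlbaneseId.albStarQ J K x)) := by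
  apply Subtype.ext
  funext g'
  rw [coe_albStarQ_apply, coe_restrictQ_apply, coe_translateQ_apply, coe_albStarQ_apply, trPullQ_one_one]
  exact LinearMap.congr_fun (J.pull_alb_albTr g hK g') x

end ComponentAlbaneseId

/-! ## §4  The level-wise Betti data AT THE PIN and its laws -/

-- (`LevelwiseBettiPullback.PΩ_injective_of_levelwise` is P5-generic: imported from the twisted original, not re-declared)

section Pin

variable {Lg : Type} [Field Lg] [NumberField Lg] [IsGalois ℚ Lg] (emb : L →ₐ[ℚ] Lg) (ιg : Lg →+* ℂ)
  {μ : Literature.NumberTheory.Automorphic.IdeleClassGroup L →ₜ* Circle}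
  (hμ : Literature.NumberTheory.Automorphic.IdeleClassGroup.IsConjugateSymplectic L μ)
  (hw : Literature.NumberTheory.Automorphic.IdeleClassGroup.HasWeight L μ 1) (Car : Def45.Carriers L μ)

/-- **THE LEVEL-WISE BETTI DATA AT THE PIN** (`LevelwiseBettiPullback`, [Liu2021] proof of Thm. 4.18 l. 2248–2250 with §4.2 l. 2062–2081),
every field HONEST: `AKQ K := H¹_B((A_K ⊗_{E,ι₁} ℂ)(ℂ); ℚ)`; `phiStarQ K φ := (φ ⊗ ℂ)^*` (additive: `Hom.baseChange_add`, `pull_add_one`);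
`pbQ u := (u ⊗ ℂ)^*` along ANY `u : A_{K'} → A_K`; `phiStarQ_comp` = `Hom.baseChange_comp` + `pull_comp`; `transKQ K := ofQ Γ_K ∘ albStarQ K`;
`transKQ_Atr` = LAW (iii) + J1 `ofQ_restrictQ`. [cite: Liu2021, §4.2 (FJcycle.tex l. 2062–2081) and proof of Thm. 4.18 (l. 2248–2250)] -/
def levelwisePin (Dμ : ObjOne emb ιg hμ hw Car) :
    LevelwiseBettiPullback C (AμOne emb ιg hμ hw Car Dμ) (bettiCohomology (AμC emb ιg hμ hw Car Dμ).X 1)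
      (TowerQ hHD hI hU h₃ hA V) where
  AKQ K := bettiCohomology ((C.A K).baseChange ℂ).X 1
  phiStarQ K :=
    { toFun := fun φ => BettiUniverse.pull (AbelianVariety.Hom.baseChange ℂ φ).hom.hom.hom 1
      map_zero' := by
        show BettiUniverse.pull (AbelianVariety.Hom.baseChange ℂ (0 : C.A K ⟶ AμOne emb ιg hμ hw Car Dμ)).hom.hom.hom 1 = 0
        rw [AbelianVariety.Hom.baseChange_zero]
        exact pull_zero_one
      map_add' := fun φ ψ => by
        show BettiUniverse.pull (AbelianVariety.Hom.baseChange ℂ (φ + ψ)).hom.hom.hom 1 = _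
        rw [AbelianVariety.Hom.baseChange_add]
        exact pull_add_one _ _ }
  pbQ u := BettiUniverse.pull (AbelianVariety.Hom.baseChange ℂ u).hom.hom.hom 1
  phiStarQ_comp u φ := by
    show BettiUniverse.pull (AbelianVariety.Hom.baseChange ℂ (u ≫ φ)).hom.hom.hom 1 =
      BettiUniverse.pull (AbelianVariety.Hom.baseChange ℂ u).hom.hom.hom 1 ∘ₗ
        BettiUniverse.pull (AbelianVariety.Hom.baseChange ℂ φ).hom.hom.hom 1
    rw [AbelianVariety.Hom.baseChange_comp, pull_comp_hom]
  transKQ K := ofQ hHD hI hU h₃ hA (J.Γof K) (J.belowConjThree K) ∘ₗ J.albStarQ K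
  transKQ_Atr f := by
    refine LinearMap.ext fun x => ?_
    rw [LinearMap.comp_apply, LinearMap.comp_apply, LinearMap.comp_apply, J.albStarQ_pull_Atr f x, ofQ_restrictQ]

/-- Unfolding: `(levelwisePin …).phiStarQ K φ = (φ ⊗ ℂ)^*`. [cite: Liu2021, proof of Thm. 4.18 (FJcycle.tex l. 2248–2250)] -/
theorem levelwisePin_phiStarQ (Dμ : ObjOne emb ιg hμ hw Car) (K : C5.SmallLevel C.S.K₀) (φ : C.A K ⟶ AμOne emb ιg hμ hw Car Dμ) :
    (Iota1.levelwisePin J emb ιg hμ hw Car Dμ).phiStarQ K φ = BettiUniverse.pull (AbelianVariety.Hom.baseChange ℂ φ).hom.hom.hom 1 :=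
  rfl

/-- Unfolding: `(levelwisePin …).transKQ K = ofQ Γ_K ∘ albStarQ K`. [cite: Liu2021, §4.2 (FJcycle.tex l. 2070–2072)] -/
theorem levelwisePin_transKQ (Dμ : ObjOne emb ιg hμ hw Car) (K : C5.SmallLevel C.S.K₀) :
    (Iota1.levelwisePin J emb ιg hμ hw Car Dμ).transKQ K = ofQ hHD hI hU h₃ hA (J.Γof K) (J.belowConjThree K) ∘ₗ ComponentAlbaneseId.albStarQ J K :=
  rfl

/-- **`hpost` at the pin** — functoriality `(φ ≫ β)^* = φ^* ∘ β^*` for an endomorphism `β` of `A_μ`, the `β^*` being HcmMLine's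
`endStarQOne (1 ⊗ β) = (β ⊗ ℂ)^*` (`endStarQOne_of`): the input `hpost` of `map43RecordOfLevels` ∕ `PΩ_smul'`.
[cite: Liu2021, Def. 4.16 (FJcycle.tex l. 2219) and proof of Thm. 4.18 (l. 2248–2250)] -/
theorem levelwisePin_hpost (Dμ : ObjOne emb ιg hμ hw Car) (K : C5.SmallLevel C.S.K₀) (φ : C.A K ⟶ AμOne emb ιg hμ hw Car Dμ)
    (β : End (AμOne emb ιg hμ hw Car Dμ)) :
    (Iota1.levelwisePin J emb ιg hμ hw Car Dμ).phiStarQ K (φ ≫ End.asHom β) =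
      (Iota1.levelwisePin J emb ιg hμ hw Car Dμ).phiStarQ K φ ∘ₗ
        endStarQOne emb ιg hμ hw Car Dμ (AbelianVariety.endAlgebra.of _ β) := by
  rw [levelwisePin_phiStarQ, levelwisePin_phiStarQ, endStarQOne_of, AbelianVariety.Hom.baseChange_comp, pull_comp_hom]
  rfl

variable (hHD hI hU h₃ hA C) in
/-- J1's `towerRepQ` (the `U(V)(𝔸_f)`-action on the rational tower), READ as a representation of the §4.2 datum's group
`𝔾(𝔸_F^∞) = C.G` — the same group (`Model.honestP5Of_G`, by `rfl`); the field `ρU` of the record at the pin.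
[cite: Liu2021, §4.2 (FJcycle.tex l. 2074–2081)] -/
def ρUPin : Representation ℚ C.G (TowerQ hHD hI hU h₃ hA V) :=
  (towerRepQ hHD hI hU h₃ hA V :)

variable (hHD hI hU h₃ hA C) in
/-- J1's/the model's `towerRep` (the `U(V)(𝔸_f)`-action on the tower `T.H`), READ as a representation of `C.G`; the field `ρB` of the
record at the pin. [cite: Liu2021, §4.2 (FJcycle.tex l. 2074–2081)] -/
def ρBPin : Representation ℂ C.G (Tower hHD hI hU h₃ hA V) :=
  (towerRep hHD hI hU h₃ hA V :)

/-- **`hU` at the pin — the Hecke action on the rational tower is induced by the `Alb(T_g)^*`** ([Liu2021] §4.2 l. 2074 «the Hecke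
correspondences provide a homomorphism `𝔾(𝔸_F^∞) → Aut_E(A_∞)`»): `transK_{K₁} ∘ (Alb(T_g))_ℂ^* = ρU(g) ∘ transK_K` with
`ρU := towerRepQ`, from LAW (iv) (`albStarQ_pull_albTr`) and J1's `actQ_ofQ` ∕ `ofQ_restrictQ`. [cite: Liu2021, §4.2 (FJcycle.tex l. 2070–2074) and Def. 4.16 (l. 2219)] -/
theorem levelwisePin_hU (Dμ : ObjOne emb ιg hμ hw Car) (g : ↥V.adelicFin) (K₁ K : C5.SmallLevel C.S.K₀) (hK : C5.HeckeLE g K₁ K) :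
    (Iota1.levelwisePin J emb ιg hμ hw Car Dμ).transKQ K₁ ∘ₗ (Iota1.levelwisePin J emb ιg hμ hw Car Dμ).pbQ (T.albTr g K₁ K hK) =
      ρUPin hHD hI hU h₃ hA C g ∘ₗ
        (Iota1.levelwisePin J emb ιg hμ hw Car Dμ).transKQ K := by
  refine LinearMap.ext fun x => ?_
  show ofQ hHD hI hU h₃ hA (J.Γof K₁) (J.belowConjThree K₁)
      (J.albStarQ K₁ (BettiUniverse.pull (AbelianVariety.Hom.baseChange ℂ (T.albTr g K₁ K hK)).hom.hom.hom 1 x)) =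
    towerRepQ hHD hI hU h₃ hA V g (ofQ hHD hI hU h₃ hA (J.Γof K) (J.belowConjThree K) (J.albStarQ K x))
  rw [J.albStarQ_pull_albTr g hK x, ofQ_restrictQ, towerRepQ_apply, actQ_ofQ]

/-- **Level-wise injectivity at the pin**: `t ↦ transK ∘ t^*` is injective on `Hom_E(A_K, A_μ)_ℚ = ℚ ⊗_ℤ Hom` — common denominators
(J3 `TensorProduct.exists_inv_natCast_tmul`), injectivity of `ofQ` (J1), HOM-LEVEL DETECTION by the components (LAW (v′)),
nothing else (the faithfulness of rational `H¹` on homomorphisms is INSIDE (v′) at the pin). [cite: Liu2021, proof of Thm. 4.18 (FJcycle.tex l. 2248–2266)] -/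
theorem levelwisePin_level_injective (Dμ : ObjOne emb ιg hμ hw Car) (K : C5.SmallLevel C.S.K₀)
    (t : C.HomQ K (AμOne emb ιg hμ hw Car Dμ))
    (ht : (Iota1.levelwisePin J emb ιg hμ hw Car Dμ).transKQ K ∘ₗ (Iota1.levelwisePin J emb ιg hμ hw Car Dμ).phiStarQHom K t = 0) :
    t = 0 := by
  obtain ⟨N, hN, f, rfl⟩ := TensorProduct.exists_inv_natCast_tmul t
  have hN' : ((N : ℚ)⁻¹) ≠ 0 := inv_ne_zero (Nat.cast_ne_zero.mpr hN.ne')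
  rw [LevelwiseBettiPullback.phiStarQHom_tmul, LinearMap.comp_smul, smul_eq_zero] at ht
  have h0 : (levelwisePin J emb ιg hμ hw Car Dμ).transKQ K ∘ₗ (levelwisePin J emb ιg hμ hw Car Dμ).phiStarQ K f = 0 :=
    ht.resolve_left hN'
  -- `albStarQ K ∘ (f ⊗ ℂ)^* = 0` (`ofQ` is injective), i.e. `(alb K h ≫ (f ⊗ ℂ))^* = 0` for every index `h`
  have h1 : ∀ g : ↥V.adelicFin,
      BettiUniverse.pull (J.alb K g ≫ (AbelianVariety.Hom.baseChange ℂ f).hom.hom.hom) 1 = 0 := by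
    intro g
    refine LinearMap.ext fun y => ?_
    have hy : ofQ hHD hI hU h₃ hA (J.Γof K) (J.belowConjThree K)
        (J.albStarQ K (BettiUniverse.pull (AbelianVariety.Hom.baseChange ℂ f).hom.hom.hom 1 y)) = 0 :=
      LinearMap.congr_fun h0 y
    have hy' := congrArg (fun c : ↥(levelQ hHD hI hU h₃ hA (J.Γof K) (J.belowConjThree K)) =>
      (c : Π g : ↥V.adelicFin, WQ hHD hI hU h₃ (J.Γof K) (J.belowConjThree K) g) g)
      (ofQ_injective hHD hI hU h₃ hA _ _ (hy.trans (map_zero _).symm))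
    simp only [Submodule.coe_zero, Pi.zero_apply] at hy'
    rw [BettiUniverse.pull_comp]
    exact hy'
  rw [J.eq_zero_of_pull_alb_comp_eq_zero K f h1, TensorProduct.tmul_zero]

open scoped Classical in
/-- **`P_injective` at the pin**: the constructed (4.2) `PΩ` on `Ω(μ) = colim_K Hom_E(A_K, A_μ)_ℚ` is injective.
[cite: Liu2021, proof of Thm. 4.18 (FJcycle.tex l. 2248–2266)] -/
theorem levelwisePin_PΩ_injective (Dμ : ObjOne emb ιg hμ hw Car) :
    Function.Injective ((Iota1.levelwisePin J emb ιg hμ hw Car Dμ).PΩ (fieldOfValues L μ)) :=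
  (levelwisePin J emb ιg hμ hw Car Dμ).PΩ_injective_of_levelwise (fieldOfValues L μ)
    (levelwisePin_level_injective J emb ιg hμ hw Car Dμ)

/-! ## §5  THE RECORD AT THE PIN -/

variable (Eps : Type) (epsOf : L → Eps) (Chi : Type) (omega : Eps → Chi → Type)
  [∀ ε χ, AddCommGroup (omega ε χ)] [∀ ε χ, Module ℂ (omega ε χ)] (rho : ∀ ε χ, Representation ℂ C.G (omega ε χ))

open scoped Classical in
/-- **THE PROOF-OBJECTS RECORD (4.2)/(4.3) AT THE PIN** ([Liu2021] proof of Thm. 4.18, l. 2247–2253; the Δ2 binder group R2 «`M`»), over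
`toThm418Data C (T.restOne …)` (REAL `Obj ∕ A_μ ∕ Ω(μ) ∕ rhoΩ ∕ res`): `Dμ ∈ 𝒜(μ)` (Prop. 4.6 (1)); `τ' ∈ Φ_μ` (l. 2250); BY NAME from J1
`U := TowerQ`, `ρU := towerRepQ`, `HB := Tower … V` (`= T.H`), `ρB := towerRep`, `ι := ιT` (`ιT_injective`, `ιT_comm`); BY NAME from `HcmMLine`
`L := H¹_B((A_μ ⊗ ℂ)(ℂ); ℚ)` as an `M_μ`-line through `i_μ` with the eigenvector `α`; `P := PΩOne … (levelwisePin …)` — the CONSTRUCTED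
(4.2) — with `P_smul` (`PΩ_smul'` + `levelwisePin_hpost` + `smul_eq_endStarQOne`), `P_comm` (`PΩOne_rhoΩOne` + `levelwisePin_hU`) and
`P_injective` (`levelwisePin_PΩ_injective`) DISCHARGED; pin inputs left displayed: `J`, `Dμ`, `τ' ∕ hτ'`.  At μ-uniform carriers `U` this IS
the (c) binder of the assembler's signatures (`U.rest (restTailOne …) = T.restOne …`, `UniformOmega.restOne_eq_rest`, `rfl`).  HC_CM is NOT
proved; «Δ2 BRIDGE CLOSED» is NOT claimed. [cite: Liu2021, proof of Thm. 4.18 (FJcycle.tex l. 2247–2253); Rem. 4.17; Def. 4.16 (l. 2219); §4.2 (l. 2070–2081); l. 650 with Def. 4.5 (2)] -/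
def map43RecordAtPin (Dμ : ObjOne emb ιg hμ hw Car) (τ' : L →+* ℂ) (hτ' : τ' ∈ hμ.cmType.1) :
    (toThm418Data C (T.restOne emb ιg hμ hw Car Eps epsOf Chi omega rho)).Map43RationalData :=
  letI := lineModuleOne emb ιg hμ hw Car Dμ
  haveI := isScalarTower_lineModuleOne emb ιg hμ hw Car Dμ
  { Dμ := Dμ
    τ' := τ'
    τ'_mem := hτ'
    U := TowerQ hHD hI hU h₃ hA V
    instAddCommGroupU := inferInstance
    instModuleU := inferInstance
    ρU := ρUPin hHD hI hU h₃ hA C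
    HB := Tower hHD hI hU h₃ hA V
    instAddCommGroupHB := inferInstance
    instModuleHB := inferInstance
    ρB := ρBPin hHD hI hU h₃ hA C
    ι := ιT hHD hI hU h₃ hA V
    ι_injective := ιT_injective hHD hI hU h₃ hA V
    ι_comm := fun g x => ιT_comm hHD hI hU h₃ hA g x
    L := bettiCohomology (AμC emb ιg hμ hw Car Dμ).X 1
    instModuleL := lineModuleOne emb ιg hμ hw Car Dμ
    instTowerL := isScalarTower_lineModuleOne emb ιg hμ hw Car Dμ
    rank_L := finrank_lineModuleOne emb ιg hμ hw Car Dμ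
    α := (exists_eigenvectorOne emb ιg hμ hw Car Dμ).choose
    α_mem := (exists_eigenvectorOne emb ιg hμ hw Car Dμ).choose_spec.1
    α_ne := (exists_eigenvectorOne emb ιg hμ hw Car Dμ).choose_spec.2
    P := PΩOne C emb ιg hμ hw Car Dμ (levelwisePin J emb ιg hμ hw Car Dμ)
    P_smul := fun m f =>
      (levelwisePin J emb ιg hμ hw Car Dμ).PΩ_smul' (fieldOfValues L μ) (endStarQOne emb ιg hμ hw Car Dμ)
        (levelwisePin_hpost J emb ιg hμ hw Car Dμ) (smul_eq_endStarQOne emb ιg hμ hw Car Dμ) m (f Dμ)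
    P_comm := fun g f => by
      show PΩOne C emb ιg hμ hw Car Dμ (levelwisePin J emb ιg hμ hw Car Dμ) (T.rhoΩOne emb ιg hμ hw Car g f) =
        ρUPin hHD hI hU h₃ hA C g ∘ₗ PΩOne C emb ιg hμ hw Car Dμ (levelwisePin J emb ιg hμ hw Car Dμ) f
      exact PΩOne_rhoΩOne T (ρUPin hHD hI hU h₃ hA C) emb ιg hμ hw Car Dμ
        (levelwisePin J emb ιg hμ hw Car Dμ) (levelwisePin_hU J emb ιg hμ hw Car Dμ) g f
    P_injective :=
      (levelwisePin_PΩ_injective J emb ιg hμ hw Car Dμ).comp (eval_objOne_injective emb ιg hμ hw Car Dμ) }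

/-- **S2 field `AK` at the pin**: `H¹_B((A_K ⊗_{E,ι₁} ℂ)(ℂ); ℂ) = ℂ ⊗_ℚ H¹_B(−; ℚ)` at the level `levelOf K` of the open compact `K`.
[cite: Liu2021, §4.2 (FJcycle.tex l. 2062–2070)] -/
abbrev AKPin (K : Subgroup C.G) : Type :=
  ℂ ⊗[ℚ] bettiCohomology ((C.A (C.levelOf K)).baseChange ℂ).X 1

/-- **S2 field `transK` at the pin**: `(ofQ Γ_K ∘ albStarQ K) ⊗ ℂ` followed by `ιT`, into the tower `T.H`. [cite: Liu2021, §4.2 (FJcycle.tex l. 2070–2072)] -/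
def transKPin (K : Subgroup C.G) : AKPin (C := C) K →ₗ[ℂ] Tower hHD hI hU h₃ hA V :=
  ιT hHD hI hU h₃ hA V ∘ₗ
    (ofQ hHD hI hU h₃ hA (J.Γof (C.levelOf K)) (J.belowConjThree (C.levelOf K)) ∘ₗ J.albStarQ (C.levelOf K)).baseChange ℂ

/-- **S2 field `phiStar` at the pin**: `φ ↦ (φ ⊗ ℂ)^* ⊗ ℂ`, `ℚ`-linearly in `φ ∈ Hom_E(A_K, A_μ)_ℚ` (`phiStarQHom` of `levelwisePin`).
[cite: Liu2021, Thm. 4.18 (1) (FJcycle.tex l. 2239) and proof (l. 2248–2250)] -/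
def phiStarPin (Dμ : ObjOne emb ιg hμ hw Car) (K : Subgroup C.G)
    (φ : (toThm418Data C (T.restOne emb ιg hμ hw Car Eps epsOf Chi omega rho)).HomK K Dμ) :
    ℂ ⊗[ℚ] bettiCohomology (AμC emb ιg hμ hw Car Dμ).X 1 →ₗ[ℂ] AKPin (C := C) K :=
  ((levelwisePin J emb ιg hμ hw Car Dμ).phiStarQHom (C.levelOf K) φ).baseChange ℂ

/-- **The S₀ binder `jH` at the pin**: the record's complex carrier `HB` IS the tower `Tower … V` (`= T.H` at `LiuDictionary.ofTower`), read by
the identity. [cite: Liu2021, §4.2 (FJcycle.tex l. 2076–2081)] -/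
def jHPin (Dμ : ObjOne emb ιg hμ hw Car) (τ' : L →+* ℂ) (hτ' : τ' ∈ hμ.cmType.1) :
    (map43RecordAtPin J emb ιg hμ hw Car Eps epsOf Chi omega rho Dμ τ' hτ').HB →ₗ[ℂ] Tower hHD hI hU h₃ hA V :=
  LinearMap.id

end Pin

end Summit.HodgeConjecture.CorCM.D2Bridge.Iota1

end
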